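import Summits.CriticalPhenomena.PercolationContinuityZ3.Theorems.PercNearOneGluingNoHeavyLowerTailSahiGridPatternRoundingLinear
import Summits.CriticalPhenomena.PercolationContinuityZ3.Theorems.PercNearOneGluingNoHeavyLowerTailSahiGridPatternFaces

/-!
# `NoHeavyLowerTail` (crux stmt-CriticalPhenomena-4575), Sahi programme P1: the rounding calculus, part 4 —
# **THE ROUNDING ALTERNATIVE REDUCES TO SHARED DESCENTS**

Support file (seat `prim-sahi-p1`, generation 12; `--supports stmt-CriticalPhenomena-4575`).  Pure proofs; one finite `Prop` (`SharedRoundingAlternative d`,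
an obligation / hypothesis, never a fact); no `sorry`, standard axioms.  Vocabulary of `…SahiGridPatternRounding{,Linear}` and `…Faces` (`sStarD_swap12/23`).

THE MATHEMATICS.  On an axis `a`, a level pair `j` is SHARED for `(A,B,C)` if at least two of the three sets are not `(lo j, hi j)`-invariant there.  If an
UNRESOLVED axis carries a level pair that is not shared, then exactly one set has a descent there (none would make the axis resolved) and, the other two
being invariant, Lieb–Sahi linearity (`sStarD_roundUp_add_roundDown`, part 2) provides a non-increasing rounding at once (`exists_good_rounding_of_not_shared`).
Hence **`roundingAlternative_of_shared : SharedRoundingAlternative d → RoundingAlternative d`**, where `SharedRoundingAlternative d` asks for a non-increasing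
rounding only for the triples ALL of whose unresolved axes have BOTH level pairs shared — the genuinely open configurations (seat census: this is where the
single-pair and uniform-sign forms of the alternative fail, `d = 3, 4` witnesses in the seat memo).  With parts 1 and 3:
`SharedRoundingAlternative d → (PatternPos d ↔ twisted three-partition positivity on d letters)` (`patternPos_iff_twistedTPP_of_shared`).
HONEST LABEL: `SharedRoundingAlternative d` is OPEN for `d ≥ 4` (`d ≤ 3`: exhaustive seat computation); nothing here asserts `PatternPos d` (`d ≥ 4`). [this work]
-/

namespace Summit.CriticalPhenomena.PercolationContinuityZ3.Theorems.SahiGridPattern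

open Finset
open scoped Classical

variable {d : ℕ}

/-- An invariant set is fixed by `roundUp`. [this work] -/
theorem roundUp_eq_self_of_axInv {a : Fin d} {j : Fin 2} {X : Finset (Pd d)} (h : AxInv a (lo j) (hi j) X) : roundUp a j X = X := by
  ext x
  rw [mem_roundUp]
  constructor
  · rintro (hx | ⟨hxa, hx⟩)
    · exact hx
    · rw [← axSwap_eq_update_of_eq_left hxa] at hx; exact (h x).2 hx
  · exact Or.inl

/-- An invariant set is fixed by `roundDown`. [this work] -/
theorem roundDown_eq_self_of_axInv {a : Fin d} {j : Fin 2} {X : Finset (Pd d)} (h : AxInv a (lo j) (hi j) X) : roundDown a j X = X := by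
  ext x
  rw [mem_roundDown]
  constructor
  · exact fun hx => hx.1
  · intro hx
    refine ⟨hx, fun hxa => ?_⟩
    rw [← axSwap_eq_update_of_eq_right hxa]; exact (h x).1 hx

/-- An invariant set is fixed by every signed rounding. [this work] -/
theorem rnd_eq_self_of_axInv (s : Bool) {a : Fin d} {j : Fin 2} {X : Finset (Pd d)} (h : AxInv a (lo j) (hi j) X) : rnd s a j X = X := by
  unfold rnd; split_ifs
  · exact roundUp_eq_self_of_axInv h
  · exact roundDown_eq_self_of_axInv h

/-- The signed roundings of `A` realise `roundUp` and `roundDown`. [this work] -/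
theorem rnd_true (a : Fin d) (j : Fin 2) (X : Finset (Pd d)) : rnd true a j X = roundUp a j X := by unfold rnd; simp

/-- The signed roundings of `A` realise `roundUp` and `roundDown`. [this work] -/
theorem rnd_false (a : Fin d) (j : Fin 2) (X : Finset (Pd d)) : rnd false a j X = roundDown a j X := by unfold rnd; simp

/-- One of the two roundings of the FIRST slot is non-increasing when the other two slots are invariant. [this work] -/
theorem exists_rnd_le₁ (a : Fin d) (j : Fin 2) {A B C : Finset (Pd d)} (hA : IsUpperSet (A : Set (Pd d)))
    (hB : AxInv a (lo j) (hi j) B) (hC : AxInv a (lo j) (hi j) C) :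
    ∃ s : Bool, sStarD (rnd s a j A) B C ≤ sStarD A B C := by
  have h := sStarD_roundUp_add_roundDown a j hA hB hC
  by_cases hle : sStarD (roundUp a j A) B C ≤ sStarD A B C
  · exact ⟨true, by rw [rnd_true]; exact hle⟩
  · exact ⟨false, by rw [rnd_false]; linarith⟩

/-- A level pair `j` on axis `a` is SHARED: at least two of the three sets have a descent there (are not `(lo j, hi j)`-invariant). [this work] -/
def Shared (a : Fin d) (j : Fin 2) (A B C : Finset (Pd d)) : Prop :=
  (¬ AxInv a (lo j) (hi j) A ∧ ¬ AxInv a (lo j) (hi j) B) ∨ (¬ AxInv a (lo j) (hi j) A ∧ ¬ AxInv a (lo j) (hi j) C) ∨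
    (¬ AxInv a (lo j) (hi j) B ∧ ¬ AxInv a (lo j) (hi j) C)

/-- **A non-shared pair on an unresolved axis yields a non-increasing rounding** (by Lieb–Sahi linearity). [this work] -/
theorem exists_good_rounding_of_not_shared {a : Fin d} {j : Fin 2} {A B C : Finset (Pd d)} (hA : IsUpperSet (A : Set (Pd d)))
    (hB : IsUpperSet (B : Set (Pd d))) (hC : IsUpperSet (C : Set (Pd d))) (hns : ¬ Shared a j A B C) :
    ∃ sA sB sC : Bool, sStarD (rnd sA a j A) (rnd sB a j B) (rnd sC a j C) ≤ sStarD A B C := by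
  unfold Shared at hns
  have h1 : ¬ (¬ AxInv a (lo j) (hi j) A ∧ ¬ AxInv a (lo j) (hi j) B) := fun h => hns (Or.inl h)
  have h2 : ¬ (¬ AxInv a (lo j) (hi j) A ∧ ¬ AxInv a (lo j) (hi j) C) := fun h => hns (Or.inr (Or.inl h))
  have h3 : ¬ (¬ AxInv a (lo j) (hi j) B ∧ ¬ AxInv a (lo j) (hi j) C) := fun h => hns (Or.inr (Or.inr h))
  by_cases hAi : AxInv a (lo j) (hi j) A
  · by_cases hBi : AxInv a (lo j) (hi j) B
    · -- only C may move
      obtain ⟨s, hs⟩ := exists_rnd_le₁ a j hC hAi hBi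
      refine ⟨true, true, s, ?_⟩
      rw [rnd_eq_self_of_axInv true hAi, rnd_eq_self_of_axInv true hBi, sStarD_swap23, sStarD_swap12, sStarD_swap23 A B C,
        sStarD_swap12 A C B]
      exact hs
    · -- B moves, C invariant
      have hCi : AxInv a (lo j) (hi j) C := by by_contra hCi; exact h3 ⟨hBi, hCi⟩
      obtain ⟨s, hs⟩ := exists_rnd_le₁ a j hB hAi hCi
      refine ⟨true, s, true, ?_⟩
      rw [rnd_eq_self_of_axInv true hAi, rnd_eq_self_of_axInv true hCi, sStarD_swap12, sStarD_swap12 A B C]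
      exact hs
  · have hBi : AxInv a (lo j) (hi j) B := by by_contra hBi; exact h1 ⟨hAi, hBi⟩
    have hCi : AxInv a (lo j) (hi j) C := by by_contra hCi; exact h2 ⟨hAi, hCi⟩
    obtain ⟨s, hs⟩ := exists_rnd_le₁ a j hA hBi hCi
    exact ⟨s, true, true, by rw [rnd_eq_self_of_axInv true hBi, rnd_eq_self_of_axInv true hCi]; exact hs⟩

/-- **`SharedRoundingAlternative d`**: the rounding alternative restricted to the triples all of whose unresolved axes have BOTH level pairs shared
(the configurations not settled by Lieb–Sahi linearity).  An OPEN finite statement; an obligation / hypothesis, never a fact. [this work]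
[status: open for d ≥ 4; d ≤ 3 exhaustive seat computation] -/
@[conjecture] def SharedRoundingAlternative (d : ℕ) : Prop :=
  ∀ A B C : Finset (Pd d), IsUpperSet (A : Set (Pd d)) → IsUpperSet (B : Set (Pd d)) → IsUpperSet (C : Set (Pd d)) →
    (∃ a, ¬ Resolved a A B C) → (∀ a, ¬ Resolved a A B C → ∀ j, Shared a j A B C) →
      ∃ (a : Fin d) (j : Fin 2) (sA sB sC : Bool), ¬ Resolved a A B C ∧
        sStarD (rnd sA a j A) (rnd sB a j B) (rnd sC a j C) ≤ sStarD A B C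

/-- **The rounding alternative reduces to the shared configurations.** [this work] -/
theorem roundingAlternative_of_shared (h : SharedRoundingAlternative d) : RoundingAlternative d := by
  intro A B C hA hB hC hex
  by_cases hall : ∀ a, ¬ Resolved a A B C → ∀ j, Shared a j A B C
  · exact h A B C hA hB hC hex hall
  · obtain ⟨a, ha⟩ := not_forall.1 hall
    obtain ⟨hna, hj⟩ := Classical.not_imp.1 ha
    obtain ⟨j, hns⟩ := not_forall.1 hj
    obtain ⟨sA, sB, sC, hle⟩ := exists_good_rounding_of_not_shared hA hB hC hns
    exact ⟨a, j, sA, sB, sC, hna, hle⟩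

/-- Hence, for the shared configurations alone: `SharedRoundingAlternative d → ResolvedPos d → PatternPos d`. [this work] -/
theorem patternPos_of_shared (h : SharedRoundingAlternative d) (hRP : ResolvedPos d) : PatternPos d :=
  patternPos_of_roundingAlternative (roundingAlternative_of_shared h) hRP

end Summit.CriticalPhenomena.PercolationContinuityZ3.Theorems.SahiGridPattern
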